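import Literature.NumberTheory.Transcendental.KaehlerHodgeDolbeaultHarmonicCounterexample
import Literature.NumberTheory.Transcendental.KaehlerHodgeConjProofs
import HarnessLib

/-!
# The named fact `dolbeaultHarmonicForms_le_dolbeaultClosedForms` is false as stated

Theorems-only companion of `Literature/NumberTheory/Transcendental/KaehlerHodge.lean` (C12) and of
`KaehlerHodgeHarmonicClosedProofs.lean` (the intended statement, its bridge and the corrected named
fact `dolbeaultHarmonicForms_le_dolbeaultClosedForms_of_isManifold` with its discharge).

`KaehlerHodge.lean` records "`∂̄`-harmonic `(p,q)`-forms are `∂̄`-closed (compact Hermitian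
manifold), so `ℋ^{p,q} ≤ Z^{p,q}_{∂̄}`" — C. Voisin, *Hodge Theory and Complex Algebraic Geometry I*
(2002), §5.1.4, Cor. 5.13 (`Ker Δ = Ker d ∩ Ker d*` "and the analogous equalities for the three
other Laplacians", from Lemma 5.12 `(α, Δα) = ‖dα‖² + ‖d*α‖²` and Lemma 5.8, `∂̄* = -*∂*` the formal
adjoint of `∂̄` on a *complex* manifold); D. Huybrechts, *Complex Geometry* (2005), Lemma 3.2.5 —
as the named fact `Literature.NumberTheory.Transcendental.dolbeaultHarmonicForms_le_dolbeaultClosedForms g o`,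
a `def … : Prop` written in `section Hermitian` after
`variable … [IsManifold 𝓘(ℂ, E) ω M] [IsManifold 𝓘(ℝ, E) ∞ M] (g …) (o …)`.

**Finding** (recorded in `KaehlerHodgeHarmonicClosedProofs.lean`). The body of the `def` does not
use the holomorphic-atlas instance, so Lean did not abstract it: `#check
@dolbeaultHarmonicForms_le_dolbeaultClosedForms` binds
`{E} [NormedAddCommGroup E] [NormedSpace ℂ E] {M} [TopologicalSpace M] [ChartedSpace E M] {m : ℕ}
[FiniteDimensional ℂ E] {n : ℕ} [Fact (finrank ℝ E = n)] [IsManifold 𝓘(ℝ, E) ∞ M] (g) (o)` and no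
`[IsManifold 𝓘(ℂ, E) ω M]`. The fact therefore speaks about every compact *real* `C^∞` manifold
charted on `E`, with the types `(p,q)` and `∂̄ = Σ (dα^{p,q})^{p,q+1}` read through the complex
structure `tangentJ` = multiplication by `i` in the coordinates of the *preferred chart*
`chartAt x`, which is not a tensor unless the transition maps are holomorphic. This file proves
that in that generality the fact is **false** — already in bidegree `(0,0)`, i.e. for functions,
where Voisin's Cor. 5.13 reads `Ker Δ_∂̄ = Ker ∂̄*∂̄ = Ker ∂̄`
(`TorusConjAtlas.not_dolbeaultHarmonicForms_le_dolbeaultClosedForms_torus`) —, records the universal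
closure over exactly the binders the fact elaborates with
(`not_dolbeaultHarmonicForms_le_dolbeaultClosedForms`; also the surface-level closure
`not_forall_dolbeaultHarmonicForms_le_dolbeaultClosedForms`), and hence that **no closed proof
`dolbeaultHarmonicForms_le_dolbeaultClosedForms_holds` can exist**. The intended statement carries
`[IsManifold 𝓘(ℂ, E) ω M]`: as declared it is proved *at* a complex manifold by
`dolbeaultHarmonicForms_le_dolbeaultClosedForms_of_isManifold_complex`, and with the holomorphic
atlas as a binder of the `def` itself it is the corrected named fact
`dolbeaultHarmonicForms_le_dolbeaultClosedForms_of_isManifold`, *proved*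
(`dolbeaultHarmonicForms_le_dolbeaultClosedForms_of_isManifold_holds`), both in
`KaehlerHodgeHarmonicClosedProofs.lean`.

## The counterexample (the `{id, conj}`-rigged torus of `KaehlerHodgeDolbeaultHarmonicCounterexample.lean`)

Everything about the manifold is reused from `namespace TorusConjAtlas` of that file: `M = T² = (ℝ/ℤ)²`
(compact, Hausdorff), charted on `E = ℂ` (`n = 2`) by local inverses of the covering map followed by
the frame map `L_q ∈ {id, conj}` — `conj` exactly at the points with rational first coordinate (a
dense, co-dense set) —, a real-analytic atlas (`isManifoldT`) that is not holomorphic; the flat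
`C^∞` metric `metric` (Hermitian, `isHermitian`) and the orientation family `orient` (smooth volume
form, `isSmoothForm_riemannianVolumeForm`). The witness is the **function** `G ⊗ 1 = F(x)`
(`g0.ofReal`; `F` the `1`-periodic primitive of `S = sin³(2π ·)`, in the first coordinate), in
bidegree `(p,q) = (0,0)`, `m = 2`, where `Δ_∂̄ = ∂̄*∂̄`:

* `G ⊗ 1` is smooth (`isSmoothForm_g0_ofReal`: its chart representatives are `y ↦ F(Re y)`) and,
  like every `0`-form, of type `(0,0)` (`isOfType_zero_zero`).
* `∂̄(G ⊗ 1) = \overline{∂(G ⊗ 1)} = a dz̄`, `a = S(x)/2` (`dolbeaultBar_g0_ofReal`, from the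
  unconditional `∂̄ᾱ = \overline{∂α}`, `dolbeaultBar_conj'`, and the tree's `∂(G ⊗ 1) = a dz`,
  `dolbeault_g0_ofReal`); it is **nonzero** at `proj (1/4)`, where `a = 1/2`
  (`dolbeaultBar_g0_ofReal_ne_zero`). So `G ⊗ 1 ∉ Z^{0,0}_{∂̄}`
  (`g0_ofReal_not_mem_dolbeaultClosedForms`): the span `dolbeaultClosedForms ℂ T² 0 0` of the
  smooth `∂̄`-closed `0`-forms lies in the `ℂ`-submodule of smooth `0`-forms `γ` with
  `(dγ)^{0,1} = 0` (`d` is additive on smooth forms, and `∂̄γ = (dγ)^{0,1}` for *every* `0`-form —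
  no smoothness of type components is needed in degree `0`), to which `G ⊗ 1` does not belong.
* Yet `G ⊗ 1` is "`∂̄`-harmonic" (`dolbeaultLaplacian_g0_ofReal`, `isDolbeaultHarmonic_g0_ofReal`):
  `Δ_∂̄(G ⊗ 1) = ∂̄*(\overline{∂(G ⊗ 1)}) = \overline{∂*∂(G ⊗ 1)}` (`dolbeaultBarAdjoint_conj`) and
  `∂*∂(G ⊗ 1) = -⋆∂̄⋆(a dz) = ⋆∂̄β = 0`, where `⋆(a dz) = -β`, `β = (iε S(x)/2) dz = ∂̄*α` is the
  form of the tree's refutation of `isDolbeaultHarmonic_iff` (`dolbeaultBarAdjoint_alpha`,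
  `cHodgeStar_alpha`) and **`∂̄β = 0` at every point** (`dolbeaultBar_beta`: the chart representatives
  of `β` jump with the rigging wherever `S ≠ 0` — Mathlib's `fderiv` returns the junk value `0`
  there — and vanish to second order where `S = 0`). Hence `G ⊗ 1 ∈ ℋ^{0,0}` and
  `ℋ^{0,0} ≤ Z^{0,0}_{∂̄}` fails.

Every identity used holds at every point; the only junk values are the ones the fact itself feeds
into `Δ_∂̄` (it quantifies over this real-smooth, non-holomorphic atlas). No new definition and no
named fact is introduced.

## References

* C. Voisin, *Hodge Theory and Complex Algebraic Geometry I*, Cambridge Studies in Advanced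
  Mathematics 76 (2002), §5.1.3 (Lemma 5.8), §5.1.4 (Lemma 5.12, Cor. 5.13, Def. 5.14),
  pp. 121–125 — the intended (compact complex manifold) statement. [cite: Voisin2002, §5.1.4 Cor. 5.13]
* D. Huybrechts, *Complex Geometry. An Introduction*, Universitext (2005), §3.2, Lemma 3.2.3,
  Def. 3.2.4, Lemma 3.2.5, p. 126. [cite: Huybrechts2005, Lemma 3.2.5]
-/

noncomputable section

open scoped Manifold ContDiff Topology ComplexConjugate InnerProductSpace Real
open Bundle Module Set Filter ContinuousAlternatingMap
open Literature.Geometry.Kaehler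

namespace Literature.NumberTheory.Transcendental

namespace TorusConjAtlas

section Charts

attribute [local instance] chartedSpaceT isManifoldT bundle Complex.finrank_real_complex_fact

/-! ### The function `G ⊗ 1`: smooth, with `∂̄(G ⊗ 1) = a dz̄ ≠ 0` -/

/-- **`G ⊗ 1` is smooth** (its chart representatives are `y ↦ F(Re y)`, `inChart_g0_ofReal`).
[folklore] -/
theorem isSmoothForm_g0_ofReal : IsSmoothForm g0.ofReal := by
  intro x
  rw [funext (inChart_g0_ofReal x)]
  have hF : ContDiff ℝ ∞ (fun y : ℂ ↦ ((TorusRough.F y.re : ℝ) : ℂ)) :=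
    Complex.ofRealCLM.contDiff.comp (TorusRough.contDiff_F.comp Complex.reCLM.contDiff)
  exact ((constOfIsEmptyLIE ℝ ℂ ℂ (Fin 0)).contDiff.comp hF).contDiffWithinAt

/-- **`∂̄(G ⊗ 1) = \overline{∂(G ⊗ 1)}`** (`G ⊗ 1` is real and `∂̄ ᾱ = \overline{∂α}` holds
unconditionally, `dolbeaultBar_conj'`); with `dolbeault_g0_ofReal` this is `∂̄(G ⊗ 1) = a dz̄`,
`a = S(x)/2`. Voisin (2002), §2.3.1, proof of Lemma 2.28. [cite: Voisin2002, §2.3.1] -/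
theorem dolbeaultBar_g0_ofReal : dolbeaultBar g0.ofReal = (dolbeault g0.ofReal).conj := by
  have h := dolbeaultBar_conj' g0.ofReal
  rwa [MForm.conj_ofReal] at h

/-- **`∂̄(G ⊗ 1) ≠ 0`**: at `proj (1/4)` it takes the value `\overline{a} = 1/2` on the vector `1`.
[folklore] -/
theorem dolbeaultBar_g0_ofReal_ne_zero : dolbeaultBar g0.ofReal ≠ 0 := by
  rw [dolbeaultBar_g0_ofReal, dolbeault_g0_ofReal]
  intro H
  have key := congrArg (fun γ : MForm 𝓘(ℝ, ℂ) T ℂ 1 ↦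
    γ (proj ((4⁻¹ : ℝ) : ℂ)) (![(1 : ℂ)] : Fin 1 → TangentSpace 𝓘(ℝ, ℂ) (proj ((4⁻¹ : ℝ) : ℂ)))) H
  simp only [MForm.conj_apply, a2, Sc_quarter, Pi.zero_apply, ContinuousAlternatingMap.coe_zero,
    ContinuousAlternatingMap.smul_apply, smul_eq_mul, dz_apply, Matrix.cons_val_zero, mul_one,
    Complex.conj_ofReal, Complex.ofReal_eq_zero] at key
  norm_num at key

/-- **`G ⊗ 1 ∉ Z^{0,0}_{∂̄}`.** The span `dolbeaultClosedForms ℂ T² 0 0` of the smooth `∂̄`-closed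
`0`-forms lies in the `ℂ`-submodule of smooth `0`-forms `γ` with `(dγ)^{0,1} = 0` (`d` is additive
on smooth forms, `mextDeriv_add`, and `ℂ`-linear, `mextDeriv_smul_complex_holds`; for a `0`-form
`∂̄γ = (dγ)^{0,1}`, every `0`-form being of type `(0,0)`), and `∂̄(G ⊗ 1) ≠ 0`. [folklore] -/
theorem g0_ofReal_not_mem_dolbeaultClosedForms : g0.ofReal ∉ dolbeaultClosedForms ℂ T 0 0 := by
  -- `∂̄γ = (dγ)^{0,1}` for every `0`-form `γ`
  have hdb : ∀ γ : MForm 𝓘(ℝ, ℂ) T ℂ 0,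
      dolbeaultBar γ = (mextDeriv γ).typeComponent 0 1 := fun γ ↦ by
    rw [dolbeaultBar, Finset.Nat.antidiagonal_zero, Finset.sum_singleton,
      (isOfType_zero_zero γ).typeComponent_eq_self]
  -- the smooth `0`-forms `γ` with `(dγ)^{0,1} = 0` form a `ℂ`-submodule …
  let S : Submodule ℂ (MForm 𝓘(ℝ, ℂ) T ℂ 0) :=
    { carrier := {γ | IsSmoothForm γ ∧ (mextDeriv γ).typeComponent 0 1 = 0}
      add_mem' := fun {β γ} hβ hγ ↦ ⟨hβ.1.add hγ.1, by
        rw [mextDeriv_add hβ.1 hγ.1, MForm.typeComponent_add, hβ.2, hγ.2, add_zero]⟩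
      zero_mem' := ⟨isSmoothForm_zero, by rw [mextDeriv_zero, MForm.typeComponent_zero]⟩
      smul_mem' := fun c γ hγ ↦ ⟨hγ.1.smul_complex c, by
        rw [mextDeriv_smul_complex_holds c γ, MForm.typeComponent_smul, hγ.2, smul_zero]⟩ }
  -- … containing the generators of `Z^{0,0}_{∂̄}`, hence `Z^{0,0}_{∂̄}` itself
  have hle : dolbeaultClosedForms ℂ T 0 0 ≤ S :=
    Submodule.span_le.2 fun γ hγ ↦ ⟨hγ.1, (hdb γ).symm.trans hγ.2.2⟩
  intro hmem
  exact dolbeaultBar_g0_ofReal_ne_zero ((hdb _).trans (hle hmem).2)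

/-! ### `Δ_∂̄ (G ⊗ 1) = 0`: the function `G ⊗ 1` is "`∂̄`-harmonic" -/

/-- **`Δ_∂̄(G ⊗ 1) = 0`** on the rigged torus. On functions (`k = 0`, `m = 2`) `Δ_∂̄ = ∂̄*∂̄`, and
`∂̄*∂̄(G ⊗ 1) = ∂̄*\overline{∂(G ⊗ 1)} = \overline{∂*∂(G ⊗ 1)}` (`dolbeaultBarAdjoint_conj`) with
`∂*∂(G ⊗ 1) = -⋆∂̄⋆(a dz) = ⋆∂̄β = 0`: `⋆(a dz) = -β` (read off from `∂̄*α = -⋆∂⋆α = β`,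
`⋆α = G ⊗ 1`: `dolbeaultBarAdjoint_alpha`, `cHodgeStar_alpha`) and `∂̄β = 0`
(`dolbeaultBar_beta`, the junk analysis of the tree's refutation of `isDolbeaultHarmonic_iff`).
[folklore] -/
theorem dolbeaultLaplacian_g0_ofReal (h : 0 + 0 + 2 = 2) :
    dolbeaultLaplacian orient (0 + 0) 2 h g0.ofReal = 0 := by
  have h2 : (1 + 1 + 0 : ℕ) = 2 := rfl
  have h1 : (0 + 1 + 1 : ℕ) = 2 := rfl
  -- `⋆(∂(G ⊗ 1)) = -β`
  have hstar : MForm.cHodgeStar orient h1 (dolbeault g0.ofReal) = -beta := by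
    rw [← dolbeaultBarAdjoint_alpha h2, dolbeaultBarAdjoint, cHodgeStar_alpha h2, neg_neg]
  -- `∂̄(-β) = 0`
  have hdb : dolbeaultBar (-beta) = 0 := by
    rw [← neg_one_smul ℂ beta, dolbeaultBar_smul_holds (-1 : ℂ) beta, dolbeaultBar_beta, smul_zero]
  change dolbeaultBarAdjoint orient h1 (dolbeaultBar g0.ofReal) = 0
  rw [dolbeaultBar_g0_ofReal, dolbeaultBarAdjoint_conj, dolbeaultAdjoint, hstar, hdb, _root_.map_zero,
    neg_zero, MForm.conj_zero]

/-- **`G ⊗ 1` is `∂̄`-harmonic of type `(0,0)`** on the rigged torus (smooth, of type `(0,0)`,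
`Δ_∂̄ = 0`). [folklore] -/
theorem isDolbeaultHarmonic_g0_ofReal (h : 0 + 0 + 2 = 2) :
    IsDolbeaultHarmonic orient 0 0 h g0.ofReal :=
  ⟨isSmoothForm_g0_ofReal, isOfType_zero_zero _, dolbeaultLaplacian_g0_ofReal h⟩

/-- `Ker Δ_∂̄ ⊄ Ker ∂̄` on the functions of the rigged torus: `G ⊗ 1` is `∂̄`-harmonic of type
`(0,0)` and not `∂̄`-closed (whereas Voisin (2002), Cor. 5.13 gives `Ker Δ_∂̄ = Ker ∂̄` on the
functions of a compact *complex* manifold). [folklore] -/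
theorem isDolbeaultHarmonic_and_dolbeaultBar_ne_zero (h : 0 + 0 + 2 = 2) :
    IsDolbeaultHarmonic orient 0 0 h g0.ofReal ∧ dolbeaultBar g0.ofReal ≠ 0 :=
  ⟨isDolbeaultHarmonic_g0_ofReal h, dolbeaultBar_g0_ofReal_ne_zero⟩

/-! ### Assembly -/

/-- **The named fact `dolbeaultHarmonicForms_le_dolbeaultClosedForms` is false for the rigged
torus** (`E = ℂ`, `n = 2`, `m = 2`, bidegree `(0,0)`, the flat `C^∞` metric `metric`, which is
Hermitian, and the orientation family `orient`, whose volume form is smooth): the function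
`G ⊗ 1 = F(x)` lies in `ℋ^{0,0}` (`isDolbeaultHarmonic_g0_ofReal`, `Submodule.subset_span`) but not
in `Z^{0,0}_{∂̄}` (`g0_ofReal_not_mem_dolbeaultClosedForms`). [folklore] -/
theorem not_dolbeaultHarmonicForms_le_dolbeaultClosedForms_torus :
    ¬ dolbeaultHarmonicForms_le_dolbeaultClosedForms (m := 2) metric orient := by
  intro H
  have h : (0 + 0 + 2 : ℕ) = 2 := rfl
  have hle := H isHermitian (p := 0) (q := 0) h isSmoothForm_riemannianVolumeForm
  exact g0_ofReal_not_mem_dolbeaultClosedForms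
    (hle (isDolbeaultHarmonic_g0_ofReal h).mem_dolbeaultHarmonicForms)

end Charts

end TorusConjAtlas

section UniversalClosure

attribute [local instance] TorusConjAtlas.chartedSpaceT TorusConjAtlas.isManifoldT
  Complex.finrank_real_complex_fact

/-- **`dolbeaultHarmonicForms_le_dolbeaultClosedForms` fails already over real `C^∞` surfaces
charted in `ℂ`** (smooth metric, any orientation family), with `m = 2` (bidegree `(0,0)`):
witness the rigged torus `TorusConjAtlas.T` with the flat metric
(`TorusConjAtlas.not_dolbeaultHarmonicForms_le_dolbeaultClosedForms_torus`). The intended statement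
is Voisin (2002), §5.1.4, Cor. 5.13 / Huybrechts (2005), Lemma 3.2.5, for compact complex
manifolds. [folklore] -/
theorem not_forall_dolbeaultHarmonicForms_le_dolbeaultClosedForms :
    ¬ ∀ (M : Type) [TopologicalSpace M] [ChartedSpace ℂ M] [IsManifold 𝓘(ℝ, ℂ) ∞ M]
        (g : ContMDiffRiemannianMetric 𝓘(ℝ, ℂ) ∞ ℂ (fun x : M ↦ TangentSpace 𝓘(ℝ, ℂ) x))
        (o : (x : M) → Orientation ℝ (TangentSpace 𝓘(ℝ, ℂ) x) (Fin 2)),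
        dolbeaultHarmonicForms_le_dolbeaultClosedForms (m := 2) g o :=
  fun H ↦ TorusConjAtlas.not_dolbeaultHarmonicForms_le_dolbeaultClosedForms_torus
    (H TorusConjAtlas.T TorusConjAtlas.metric TorusConjAtlas.orient)

/-- **The named fact `dolbeaultHarmonicForms_le_dolbeaultClosedForms` is false as stated.**
Closed universally over exactly the binders it elaborates with — a finite-dimensional complex
normed space `E` with `finrank ℝ E = n`, a charted space `M` over `E` that is a *real* `C^∞`
manifold (no `[IsManifold 𝓘(ℂ, E) ω M]`: the section instance is not mentioned in the body of the
`def` and was therefore not abstracted), a codegree `m`, a `C^∞` Riemannian metric `g` and an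
orientation family `o` — the statement fails: witness `E = ℂ`, `n = 2`, `m = 2` (bidegree
`(0,0)`), the compact Hausdorff torus `(ℝ/ℤ)²` with the `{id, conj}`-rigged real-analytic atlas
`TorusConjAtlas.chartedSpaceT`, the flat (Hermitian) metric and the orientation
`TorusConjAtlas.orient` (`TorusConjAtlas.not_dolbeaultHarmonicForms_le_dolbeaultClosedForms_torus`).
Hence no closed proof `dolbeaultHarmonicForms_le_dolbeaultClosedForms_holds` can exist. The
intended statement — Voisin (2002), §5.1.4, Cor. 5.13 with Def. 5.14; Huybrechts (2005), Def. 3.2.4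
and Lemma 3.2.5 — carries the complex-manifold hypothesis: as declared it holds at every complex
manifold (`dolbeaultHarmonicForms_le_dolbeaultClosedForms_of_isManifold_complex`), and it is the
corrected named fact `dolbeaultHarmonicForms_le_dolbeaultClosedForms_of_isManifold`, discharged in
`KaehlerHodgeHarmonicClosedProofs.lean`. [folklore] -/
theorem not_dolbeaultHarmonicForms_le_dolbeaultClosedForms :
    ¬ ∀ {E : Type} [NormedAddCommGroup E] [NormedSpace ℂ E] {M : Type} [TopologicalSpace M]
        [ChartedSpace E M] {m : ℕ} [FiniteDimensional ℂ E] {n : ℕ} [Fact (finrank ℝ E = n)]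
        [IsManifold 𝓘(ℝ, E) ∞ M]
        (g : ContMDiffRiemannianMetric 𝓘(ℝ, E) ∞ E (fun x : M ↦ TangentSpace 𝓘(ℝ, E) x))
        (o : (x : M) → Orientation ℝ (TangentSpace 𝓘(ℝ, E) x) (Fin n)),
        dolbeaultHarmonicForms_le_dolbeaultClosedForms (m := m) g o :=
  fun H ↦ not_forall_dolbeaultHarmonicForms_le_dolbeaultClosedForms fun M _ _ _ g o ↦
    @H ℂ _ _ M _ _ 2 _ 2 Complex.finrank_real_complex_fact _ g o

end UniversalClosure

end Literature.NumberTheory.Transcendental
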